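/-
Copyright (c) 2026. Released under Apache 2.0 license.
-/
import Mathlib.Data.Nat.Fib.Basic
import Mathlib.Data.List.PeriodicityLemma
import HarnessLib

/-!
# Fibonacci words and the optimality of the Periodicity Lemma

The Fibonacci words of Crochemore–Rytter, *Text Algorithms* (1994), §2.4 *Combinatorics of texts*
('Fibonacci words', right after the Periodicity Lemma 2.4): `Fib₀ = ε`, `Fib₁ = b`, `Fib₂ = a`,
`Fibₙ = Fibₙ₋₁ Fibₙ₋₂` (`n > 2`), here over `Fin 2` (`a = 0`, `b = 1`).  Formalised: the recursion
and the book's table, `|Fibₙ| = Fₙ` (Mathlib's `Nat.fib`), the prefix chain `Fibₙ ⊑ Fibₙ₊₁`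
(`n ≥ 2`) and `ab ⊑ Fibₙ` (`n ≥ 3`), the self-overlap `Fibₙ ⊑ Fibₙ₋₁ Fibₙ` (`n ≥ 4`: `Fibₙ` is a
prefix of `Fibₙ₋₁²`, i.e. `|Fibₙ₋₁|` is a period of `Fibₙ` in the sense of Mathlib's
`List.HasPeriod` — `hasPeriod_fibWord`; hence `Fibₙ² ⊑ Fibₙ₊₂`, `fibWord_sq_prefix`), the **near-commutation property** (`Fibₙ₊₁ Fibₙ` and
`Fibₙ Fibₙ₊₁` coincide except for their last two letters, which are exchanged — `fibWord_near_comm`),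
and the book's **extremal example for the Periodicity Lemma**: `gₙ`, the prefix of `Fibₙ` of length
`|Fibₙ| - 2` (`fibG`), satisfies `gₙ = Fibₙ₋₂ gₙ₋₁` (`fibG_eq`) and, for `n ≥ 6`, has the coprime
periods `|Fibₙ₋₁|` and `|Fibₙ₋₂|` with `|gₙ| = |Fibₙ₋₁| + |Fibₙ₋₂| - gcd - 1` while NOT having the
period `gcd = 1` (`fibG_tight`; the instances `n = 6, 7` are also evaluated by `decide`).  Thus the
bound `p + q - gcd(p, q) ≤ |x|` of the Periodicity Lemma (`List.HasPeriod.gcd` in Mathlib, see also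
`Words/FineWilf.lean`) cannot be relaxed by one, for infinitely many pairs of periods.  Lothaire's form of the same remark
(*Combinatorics on Words*, §1.3, after Prop. 1.3.5): the square `Fibₙ₊₁²` and the cube `Fibₙ³` have
a common prefix of length `Fₙ₊₁ + Fₙ - 2` (`fibWord_sq_cube_common_prefix`).

Not formalised here: `Fibₙ` has no factor `u⁴`, `|Fibₙ| ≈ Φⁿ/√5`, Sturmian words.

## References

* [CrochemoreRytter1994] M. Crochemore, W. Rytter, *Text Algorithms*, Oxford University Press
  (1994), §2.4, 'Fibonacci words' (Lemma 2.4 and the discussion following it).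
* [Lothaire1997] M. Lothaire, *Combinatorics on Words*, Cambridge University Press (1997), Ch. 1–2
  (Fibonacci and Sturmian words; the near-commutation property); §1.3, remark after Prop. 1.3.5
  (`fₙ²` and `fₙ₋₁³` have a common left factor of length `λₙ + λₙ₋₁ - 2`).
-/

namespace Literature.Combinatorics.Words

/-- The **Fibonacci words** over `Fin 2` (`0 = a`, `1 = b`): `Fib₀ = ε`, `Fib₁ = b`, `Fib₂ = a`,
`Fibₙ = Fibₙ₋₁ Fibₙ₋₂`. [cite: CrochemoreRytter1994, §2.4 Fibonacci words (definition)] -/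
def fibWord : ℕ → List (Fin 2)
  | 0 => []
  | 1 => [1]
  | 2 => [0]
  | n + 3 => fibWord (n + 2) ++ fibWord (n + 1)

/-- The recursion `Fibₙ₊₃ = Fibₙ₊₂ Fibₙ₊₁`. [cite: CrochemoreRytter1994, §2.4 Fibonacci words (definition)] -/
theorem fibWord_add_three (n : ℕ) : fibWord (n + 3) = fibWord (n + 2) ++ fibWord (n + 1) := rfl

/-- `Fib₃ = ab`, `Fib₄ = aba`, `Fib₅ = abaab`, `Fib₆ = abaababa` (the book's table).
[cite: CrochemoreRytter1994, §2.4 Fibonacci words (table)] -/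
theorem fibWord_small : fibWord 3 = [0, 1] ∧ fibWord 4 = [0, 1, 0] ∧ fibWord 5 = [0, 1, 0, 0, 1] ∧
    fibWord 6 = [0, 1, 0, 0, 1, 0, 1, 0] := by decide

/-- **`|Fibₙ| = Fₙ`**, the Fibonacci numbers. [cite: CrochemoreRytter1994, §2.4 Fibonacci words (lengths)] -/
theorem length_fibWord : ∀ n, (fibWord n).length = Nat.fib n
  | 0 => rfl
  | 1 => rfl
  | 2 => rfl
  | n + 3 => by
    have h1 := length_fibWord (n + 2)
    have h2 := length_fibWord (n + 1)
    have h3 : Nat.fib (n + 3) = Nat.fib (n + 1) + Nat.fib (n + 2) := Nat.fib_add_two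
    rw [fibWord_add_three, List.length_append, h1, h2, h3, Nat.add_comm]

/-- Fibonacci words (from `Fib₂` on) are prefixes of their successors.
[cite: CrochemoreRytter1994, §2.4 Fibonacci words (prefix property)] -/
theorem fibWord_prefix_succ (n : ℕ) (hn : 2 ≤ n) : fibWord n <+: fibWord (n + 1) := by
  obtain ⟨m, rfl⟩ := Nat.exists_eq_add_of_le hn
  rw [show 2 + m + 1 = m + 3 from by omega, fibWord_add_three, show m + 2 = 2 + m from by omega]
  exact List.prefix_append _ _

/-- **Self-overlap**: for `n ≥ 4`, `Fibₙ` is a prefix of `Fibₙ₋₁ Fibₙ` — equivalently `|Fibₙ₋₁|` is a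
period of `Fibₙ` (and `Fibₙ₋₁²` starts with `Fibₙ`). [cite: CrochemoreRytter1994, §2.4 Fibonacci words (periods)] -/
theorem fibWord_prefix_append_self (m : ℕ) :
    fibWord (m + 4) <+: fibWord (m + 3) ++ fibWord (m + 4) := by
  rw [show m + 4 = (m + 1) + 3 from rfl, fibWord_add_three]
  rw [show m + 1 + 2 = m + 3 from rfl, show m + 1 + 1 = m + 2 from rfl]
  -- `Fib_{m+3} Fib_{m+2} ⊑ Fib_{m+3} Fib_{m+3} Fib_{m+2}` since `Fib_{m+2} ⊑ Fib_{m+3}`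
  refine (List.prefix_append_right_inj (fibWord (m + 3))).mpr ?_
  exact (fibWord_prefix_succ (m + 2) (by omega)).trans (List.prefix_append _ _)

/-- Hence `|Fibₙ₋₁|` is a period of `Fibₙ` for `n ≥ 4` (Mathlib's `List.HasPeriod`).
[cite: CrochemoreRytter1994, §2.4 Fibonacci words (periods)] -/
theorem hasPeriod_fibWord (m : ℕ) : (fibWord (m + 4)).HasPeriod (Nat.fib (m + 3)) := by
  have h := fibWord_prefix_append_self m
  have hlen : (fibWord (m + 3)).length = Nat.fib (m + 3) := length_fibWord _
  have hle : Nat.fib (m + 3) ≤ (fibWord (m + 4)).length := by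
    rw [length_fibWord]; exact Nat.fib_mono (by omega)
  unfold List.HasPeriod
  have htake : (fibWord (m + 4)).take (Nat.fib (m + 3)) = fibWord (m + 3) := by
    obtain ⟨t, ht⟩ := h
    have e : (fibWord (m + 4) ++ t).take (Nat.fib (m + 3)) =
        (fibWord (m + 4)).take (Nat.fib (m + 3)) := List.take_append_of_le_length hle
    rw [← e, ht, List.take_append_of_le_length (by rw [hlen]), ← hlen, List.take_length]
  rw [htake]; exact h

/-- "The square of any Fibonacci word is a prefix of its succeeding Fibonacci words of high
enough rank": `Fibₙ² ⊑ Fibₙ₊₂` for `n ≥ 4` (as `Fibₙ₊₂ = Fibₙ Fibₙ₋₁ Fibₙ` and `Fibₙ ⊑ Fibₙ₋₁ Fibₙ`).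
[cite: CrochemoreRytter1994, §2.4 Fibonacci words (squares of Fibonacci words as prefixes)] -/
theorem fibWord_sq_prefix (m : ℕ) : fibWord (m + 4) ++ fibWord (m + 4) <+: fibWord (m + 6) := by
  have e : fibWord (m + 6) = fibWord (m + 4) ++ (fibWord (m + 3) ++ fibWord (m + 4)) := by
    have h1 : fibWord (m + 6) = fibWord (m + 5) ++ fibWord (m + 4) := fibWord_add_three (m + 3)
    have h2 : fibWord (m + 5) = fibWord (m + 4) ++ fibWord (m + 3) := fibWord_add_three (m + 2)
    rw [h1, h2, List.append_assoc]
  rw [e]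
  exact (List.prefix_append_right_inj _).mpr (fibWord_prefix_append_self m)

/-- **Near-commutation**: `Fibₙ₊₂ Fibₙ₊₁` and `Fibₙ₊₁ Fibₙ₊₂` coincide except for their last two
letters, which are exchanged (and distinct). [cite: CrochemoreRytter1994, §2.4 Fibonacci words (periods of gₙ)] -/
theorem fibWord_near_comm : ∀ n, ∃ g : List (Fin 2), ∃ x y : Fin 2, x ≠ y ∧
    fibWord (n + 2) ++ fibWord (n + 1) = g ++ [x, y] ∧ fibWord (n + 1) ++ fibWord (n + 2) = g ++ [y, x]
  | 0 => ⟨[], 0, 1, by decide, rfl, rfl⟩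
  | n + 1 => by
    obtain ⟨g, x, y, hxy, h1, h2⟩ := fibWord_near_comm n
    refine ⟨fibWord (n + 2) ++ g, y, x, hxy.symm, ?_, ?_⟩
    · rw [show n + 1 + 2 = n + 3 from rfl, fibWord_add_three, List.append_assoc,
        show n + 1 + 1 = n + 2 from rfl, h2, List.append_assoc]
    · rw [show n + 1 + 2 = n + 3 from rfl, fibWord_add_three, h1, show n + 1 + 1 = n + 2 from rfl,
        List.append_assoc]

/-- Lothaire's form of the optimality remark: the square `Fibₙ₊₁²` and the cube `Fibₙ³` have a
common prefix of length `Fₙ₊₁ + Fₙ − 2` (they first differ right after it, by near-commutation),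
although `Fₙ₊₁` and `Fₙ` are coprime periods of that prefix.
[cite: Lothaire1997, §1.3 (remark after Prop. 1.3.5: fₙ² and fₙ₋₁³ have a common left factor of length λₙ + λₙ₋₁ − 2)] -/
theorem fibWord_sq_cube_common_prefix (m : ℕ) :
    (fibWord (m + 5) ++ fibWord (m + 5)).take (Nat.fib (m + 5) + Nat.fib (m + 4) - 2) =
      (fibWord (m + 4) ++ fibWord (m + 4) ++ fibWord (m + 4)).take
        (Nat.fib (m + 5) + Nat.fib (m + 4) - 2) := by
  obtain ⟨g, x, y, -, h1, h2⟩ := fibWord_near_comm (m + 1)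
  simp only [show m + 1 + 2 = m + 3 from rfl, show m + 1 + 1 = m + 2 from rfl] at h1 h2
  have e5 : fibWord (m + 5) = fibWord (m + 4) ++ fibWord (m + 3) := fibWord_add_three (m + 2)
  have e4 : fibWord (m + 4) = fibWord (m + 3) ++ fibWord (m + 2) := fibWord_add_three (m + 1)
  have k1 : ∀ R : List (Fin 2), g ++ ([x, y] ++ R) = fibWord (m + 3) ++ (fibWord (m + 2) ++ R) :=
    fun R => by rw [← List.append_assoc, ← h1, List.append_assoc]
  have k2 : ∀ R : List (Fin 2), g ++ ([y, x] ++ R) = fibWord (m + 2) ++ (fibWord (m + 3) ++ R) :=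
    fun R => by rw [← List.append_assoc, ← h2, List.append_assoc]
  -- the common prefix is `W = Fibₙ₋₁ · g · yx · g`
  have hg : g.length = Nat.fib (m + 4) - 2 := by
    have := congrArg List.length h1
    simp only [List.length_append, length_fibWord, List.length_cons, List.length_nil] at this
    have hf : Nat.fib (m + 4) = Nat.fib (m + 2) + Nat.fib (m + 3) := Nat.fib_add_two
    omega
  have hWlen : (fibWord (m + 3) ++ (g ++ ([y, x] ++ g))).length =
      Nat.fib (m + 5) + Nat.fib (m + 4) - 2 := by
    simp only [List.length_append, length_fibWord, hg, List.length_cons, List.length_nil]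
    have hf5 : Nat.fib (m + 5) = Nat.fib (m + 3) + Nat.fib (m + 4) := Nat.fib_add_two
    have hf4 : Nat.fib (m + 4) = Nat.fib (m + 2) + Nat.fib (m + 3) := Nat.fib_add_two
    have h1le : 1 ≤ Nat.fib (m + 2) := Nat.fib_pos.mpr (by omega)
    have h1le' : 1 ≤ Nat.fib (m + 3) := Nat.fib_pos.mpr (by omega)
    omega
  have hA : fibWord (m + 5) ++ fibWord (m + 5) =
      (fibWord (m + 3) ++ (g ++ ([y, x] ++ g))) ++ ([x, y] ++ fibWord (m + 3)) := by
    rw [e5, e4]; simp only [List.append_assoc]; rw [k1, k2]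
  have hB : fibWord (m + 4) ++ fibWord (m + 4) ++ fibWord (m + 4) =
      (fibWord (m + 3) ++ (g ++ ([y, x] ++ g))) ++ ([y, x] ++ fibWord (m + 2)) := by
    rw [e4]; simp only [List.append_assoc]; rw [k2, k2]
  rw [hA, hB, ← hWlen, List.take_left, List.take_left]

/-- For instance (`n = 5`): `Fib₅² = 01001·01001` and `Fib₄³ = 010·010·010` agree on their first
`5 + 3 − 2 = 6` letters and differ at the seventh. [cite: Lothaire1997, §1.3 (remark after Prop. 1.3.5), instance] -/
example : ((fibWord 5 ++ fibWord 5).take 6 = (fibWord 4 ++ fibWord 4 ++ fibWord 4).take 6) ∧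
    (fibWord 5 ++ fibWord 5).take 7 ≠ (fibWord 4 ++ fibWord 4 ++ fibWord 4).take 7 := by decide

/-- The book's extremal example for the Periodicity Lemma, instances `n = 6, 7`: `gₙ` (the prefix of
`Fibₙ` of length `|Fibₙ| - 2`) has periods `|Fibₙ₋₁|` and `|Fibₙ₋₂|` (coprime), length
`|Fibₙ₋₁| + |Fibₙ₋₂| - gcd - 1`, and does NOT have period `gcd = 1`.
[cite: CrochemoreRytter1994, §2.4 Fibonacci words (optimality of the Periodicity Lemma)] -/
theorem fibWord_tight_examples :
    (((fibWord 6).take 6).HasPeriod 5 ∧ ((fibWord 6).take 6).HasPeriod 3 ∧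
      ¬ ((fibWord 6).take 6).HasPeriod 1 ∧ 6 = 5 + 3 - Nat.gcd 5 3 - 1) ∧
    (((fibWord 7).take 11).HasPeriod 8 ∧ ((fibWord 7).take 11).HasPeriod 5 ∧
      ¬ ((fibWord 7).take 11).HasPeriod 1 ∧ 11 = 8 + 5 - Nat.gcd 8 5 - 1) := by
  unfold List.HasPeriod; decide

/-- `Fib₃ = ab` is a prefix of every later Fibonacci word. [cite: CrochemoreRytter1994, §2.4 Fibonacci words (prefix property)] -/
theorem fibWord_three_prefix : ∀ m, fibWord 3 <+: fibWord (m + 3)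
  | 0 => List.prefix_rfl
  | m + 1 => (fibWord_three_prefix m).trans (fibWord_prefix_succ (m + 3) (by omega))

/-- **`gₙ`**: the prefix of `Fibₙ` of length `|Fibₙ| - 2` (the book's extremal words for the
Periodicity Lemma). [cite: CrochemoreRytter1994, §2.4 Fibonacci words (the words gₙ)] -/
def fibG (n : ℕ) : List (Fin 2) := (fibWord n).take (Nat.fib n - 2)

/-- `|gₙ| = |Fibₙ| - 2`. [cite: CrochemoreRytter1994, §2.4 Fibonacci words (the words gₙ)] -/
theorem length_fibG (n : ℕ) : (fibG n).length = Nat.fib n - 2 := by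
  simp [fibG, length_fibWord]

/-- The recursion of the `gₙ` hidden in the near-commutation property: `gₙ₊₂ = Fibₙ gₙ₊₁` for
`n ≥ 4` (indeed `Fibₙ₊₂ = Fibₙ Fibₙ₋₁ Fibₙ` and `Fibₙ₋₁ Fibₙ`, `Fibₙ Fibₙ₋₁ = Fibₙ₊₁` agree but for
the last two letters). [cite: CrochemoreRytter1994, §2.4 Fibonacci words (gₙ is a prefix of Fibₙ₋₂³)] -/
theorem fibG_eq (m : ℕ) : fibG (m + 6) = fibWord (m + 4) ++ fibG (m + 5) := by
  obtain ⟨g, x, y, -, h1, h2⟩ := fibWord_near_comm (m + 2)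
  have hg : g.length = Nat.fib (m + 5) - 2 := by
    have := congrArg List.length h1
    simp only [List.length_append, length_fibWord, List.length_cons, List.length_nil,
      show m + 2 + 2 = m + 4 from rfl, show m + 2 + 1 = m + 3 from rfl] at this
    have h5 : Nat.fib (m + 5) = Nat.fib (m + 3) + Nat.fib (m + 4) := Nat.fib_add_two
    omega
  have e6 : fibWord (m + 6) = fibWord (m + 4) ++ (g ++ [y, x]) := by
    rw [show m + 6 = (m + 3) + 3 from rfl, fibWord_add_three, show m + 3 + 2 = (m + 2) + 3 from rfl,
      fibWord_add_three, List.append_assoc]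
    exact congrArg _ h2
  have e5 : fibWord (m + 5) = g ++ [x, y] := by
    rw [show m + 5 = (m + 2) + 3 from rfl, fibWord_add_three]; exact h1
  have l6 : Nat.fib (m + 6) - 2 = (fibWord (m + 4)).length + g.length := by
    rw [length_fibWord, hg]
    have h6 : Nat.fib (m + 6) = Nat.fib (m + 4) + Nat.fib (m + 5) := Nat.fib_add_two
    have h5 : 2 ≤ Nat.fib (m + 5) :=
      le_trans (show 2 ≤ Nat.fib 3 by decide) (Nat.fib_mono (by omega))
    omega
  have t1 : List.take ((fibWord (m + 4)).length + g.length) (fibWord (m + 4) ++ (g ++ [y, x])) =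
      fibWord (m + 4) ++ g := by
    rw [List.take_append, List.take_of_length_le (Nat.le_add_right _ _), Nat.add_sub_cancel_left,
      List.take_append, List.take_of_length_le le_rfl, Nat.sub_self, List.take_zero, List.append_nil]
  have t2 : List.take (Nat.fib (m + 5) - 2) (fibWord (m + 5)) = g := by
    rw [e5, ← hg, List.take_append, List.take_of_length_le le_rfl, Nat.sub_self, List.take_zero,
      List.append_nil]
  unfold fibG
  rw [l6, e6, t1, t2]

/-- `gₙ₊₁ ⊑ Fibₙ gₙ₊₁` (`n ≥ 4`): the self-overlap of `Fibₙ₊₁` restricted to its prefix `gₙ₊₁`.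
[cite: CrochemoreRytter1994, §2.4 Fibonacci words (gₙ is a prefix of Fibₙ₋₁²)] -/
theorem fibG_prefix_append (m : ℕ) : fibG (m + 5) <+: fibWord (m + 4) ++ fibG (m + 5) := by
  have hs : fibWord (m + 5) <+: fibWord (m + 4) ++ fibWord (m + 5) := fibWord_prefix_append_self (m + 1)
  have hG : fibG (m + 5) <+: fibWord (m + 4) ++ fibWord (m + 5) := (List.take_prefix _ _).trans hs
  have hlen : (fibG (m + 5)).length ≤ (fibWord (m + 4)).length + (fibG (m + 5)).length :=
    Nat.le_add_left _ _
  have e1 : fibWord (m + 4) ++ fibG (m + 5) = (fibWord (m + 4) ++ fibWord (m + 5)).take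
      ((fibWord (m + 4)).length + (fibG (m + 5)).length) := by
    rw [List.take_append, List.take_of_length_le (Nat.le_add_right _ _), Nat.add_sub_cancel_left,
      length_fibG]
    rfl
  have e2 : fibG (m + 5) = (fibWord (m + 4) ++ fibWord (m + 5)).take (fibG (m + 5)).length :=
    List.prefix_iff_eq_take.mp hG
  rw [e1]
  conv_lhs => rw [e2]
  exact List.take_prefix_take_left hlen

/-- **The extremal example for the Periodicity Lemma, in general** (`n ≥ 6`): `gₙ` has the periods
`|Fibₙ₋₁|` and `|Fibₙ₋₂|`, these are coprime, `|gₙ| = |Fibₙ₋₁| + |Fibₙ₋₂| - gcd - 1` (one letter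
short of the lemma's hypothesis), and `gₙ` does NOT have the period `gcd = 1`.
[cite: CrochemoreRytter1994, §2.4 Fibonacci words (optimality of the Periodicity Lemma)] -/
theorem fibG_tight (m : ℕ) :
    (fibG (m + 6)).HasPeriod (Nat.fib (m + 5)) ∧ (fibG (m + 6)).HasPeriod (Nat.fib (m + 4)) ∧
      Nat.gcd (Nat.fib (m + 5)) (Nat.fib (m + 4)) = 1 ∧
      (fibG (m + 6)).length =
        Nat.fib (m + 5) + Nat.fib (m + 4) - Nat.gcd (Nat.fib (m + 5)) (Nat.fib (m + 4)) - 1 ∧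
      ¬ (fibG (m + 6)).HasPeriod 1 := by
  have hgcd : Nat.gcd (Nat.fib (m + 5)) (Nat.fib (m + 4)) = 1 :=
    Nat.Coprime.gcd_eq_one (Nat.fib_coprime_fib_succ (m + 4)).symm
  have h6 : Nat.fib (m + 6) = Nat.fib (m + 4) + Nat.fib (m + 5) := Nat.fib_add_two
  have hbig : 8 ≤ Nat.fib (m + 6) := le_trans (show 8 ≤ Nat.fib 6 by decide) (Nat.fib_mono (by omega))
  refine ⟨?_, ?_, hgcd, ?_, ?_⟩
  · -- period `|Fib_{n-1}|`: inherited from `Fib_n` (self-overlap)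
    have hp : (fibWord (m + 6)).HasPeriod (Nat.fib (m + 5)) := hasPeriod_fibWord (m + 2)
    exact hp.infix (List.take_prefix _ _).isInfix
  · -- period `|Fib_{n-2}|`: `g_n = Fib_{n-2} g_{n-1}` and `g_{n-1} ⊑ Fib_{n-2} g_{n-1}`
    rw [fibG_eq, List.HasPeriod, ← length_fibWord (m + 4), List.take_append_of_le_length le_rfl,
      List.take_length]
    exact (List.prefix_append_right_inj _).mpr (fibG_prefix_append m)
  · rw [length_fibG, hgcd]; omega
  · intro hper
    have h01 := (List.hasPeriod_iff_getElem?.mp hper) 0 (by rw [length_fibG]; omega)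
    obtain ⟨t, ht⟩ := fibWord_three_prefix (m + 3)
    have a0 : (fibWord 3 ++ t)[0]? = some 0 := rfl
    have a1 : (fibWord 3 ++ t)[0 + 1]? = some 1 := rfl
    unfold fibG at h01
    rw [List.getElem?_take, if_pos (by omega), List.getElem?_take, if_pos (by omega),
      show m + 6 = m + 3 + 3 from rfl, ← ht, a0, a1] at h01
    exact absurd (Option.some.inj h01) (by decide)

end Literature.Combinatorics.Words
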